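import Summits.KontsevichZagierPeriods.KontsevichZagierPeriods.Theorems.LinRedNormalFormArrangementNormalFormStubRebaseSimplePosOnePosHULocal
import Summits.KontsevichZagierPeriods.KontsevichZagierPeriods.Theorems.LinRedNormalFormArrangementNormalFormStubRebaseSimplePosOnePosHUClose
import Summits.KontsevichZagierPeriods.KontsevichZagierPeriods.Theorems.LinRedNormalFormArrangementNormalFormStubRebaseSimplePosOnePosTwoOfHU

/-!
# Stub `stub_rebaseSimplePosOnePos` (crux `ArrangementNormalForm`, line `janus-bands`) —
part `HUFinal`: the residue `HU` at `B = 2`, and the stub at `b = 0` UNCONDITIONALLY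

Assembly of parts `HUPiece`, `HUFrame`, `HUSplit`, `HURatio`, `HUDirs`, `HUChoice`, `HULocal`,
`HUClose` over the base `(x₁, x₂, y)`. The residue `HU` of `rebaseSimplePosOnePos_two_of_HU'`
(part `TwoOfHU`): a thin parallel cell over a product cell `{x'-rows} × (ylo, yhi)` whose closed
cell carries a triple point `h = w = κ' = 0` with the base pole `ℓ₂` at distance `≥ δ > 0` from
the `y`-range. It is good (`RebasePos.good_HU_two`, registered as `rebaseSimplePos_HU_two`):
* dependent height and width: `RebasePos.good_parCell_of_flat_dep` (part `ParFlatDep`);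
* otherwise the flat point `X` is the rational point `RebasePos.flatPtQ` (Cramer), the triple
  point projects to it, the `y`-range pinches there to `Y = ylo(X)`, and `|Y − ℓ₂(X)| ≥ δ`;
* choose the generic slope and level parameter `(q, θ)` (`RebasePos.exists_goodDirs`) and the
  radius `r` (`RebasePos.exists_radius`, height constant `K = ‖∇h‖₁ + ‖∇ylo‖₁`);
* localise at `X` with radius `r` (`RebasePos.good_quadCell_of_inner`, part `QuadLocal`: the
  outer pieces have no flat point), and close the inner piece by `RebasePos.good_inner`
  (quadrant and near-line chambers, re-selection of the distinguished coordinate, separation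
  engine with the rebased fibre structure preserved).
Hence `rebaseSimplePosOnePos_two'`: the stub `stub_rebaseSimplePosOnePos` at `b = 0`,
`GS 2 1 → closure (GG 2 2 1 ∪ JJ 2 2 ∪ JD 3)` modulo `KZ.relations`, with NO residual hypothesis.

References: M. Kontsevich, D. Zagier, *Periods* (2001), §1.2, rules (1a), (1b), (2).
-/

noncomputable section

open Set MeasureTheory MvPolynomial
open Literature.NumberTheory.Transcendental Literature.ModelTheory.ExponentialFields

namespace Summit.KontsevichZagierPeriods.ArrangementNormalForm.JanusBands

namespace RebasePos

open SeparatePos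

section HUFinal

variable {m m' m₀ : ℕ} (L : Fin m → (Fin 2 → ℚ) × ℚ) (e : Fin m → ℕ) (ℓ₁ ℓ₂ : (Fin 2 → ℚ) × ℚ)

/-- The height form vanishes at the flat point (Cramer). -/
theorem valX_flatPtQ_left (hF wF : (Fin 2 → ℚ) × ℚ) (hdet : detQ hF wF ≠ 0) : valX hF (flatPtQ hF wF) = 0 := by
  rw [detQ] at hdet
  simp only [valX, flatPtQ, detQ, Matrix.cons_val_zero, Matrix.cons_val_one]
  field_simp
  ring

/-- An `x'`-form at a point of the base with silent coordinates `X`. -/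
theorem affB_eq_valX (c : (Fin 2 → ℚ) × ℚ) (X : Fin 2 → ℚ) (z : Fin (2 + 1 + 1) → ℝ)
    (hz : z 0 = (X 0 : ℝ) ∧ z 1 = (X 1 : ℝ)) : affB 2 1 c z = (valX c X : ℝ) := by
  rw [affB_three, hz.1, hz.2, valX]
  push_cast
  ring

/-- An `x'`-form in terms of its value at `X` and `Δ = x − X`. -/
theorem affB_eq_valX_add (c : (Fin 2 → ℚ) × ℚ) (X : Fin 2 → ℚ) (z : Fin (2 + 1 + 1) → ℝ) :
    affB 2 1 c z = (valX c X : ℝ) + (c.1 0 : ℝ) * (z 0 - X 0) + (c.1 1 : ℝ) * (z 1 - X 1) := by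
  rw [affB_three, valX]
  push_cast
  ring

/-- **The residue `HU` at `B = 2` is good.** See the module docstring. -/
theorem good_HU_two (p : MvPolynomial (Fin 2) ℚ) (u v : (Fin (2 + 1) → ℚ) × ℚ)
    (hu : u.1 (Fin.last 2) ≠ 0) (hpar : u.1 (Fin.last 2) = v.1 (Fin.last 2))
    (s : KZ.IntegralRep (2 + 1 + 1)) (M : Fin m' → (Fin (2 + 1) → ℚ) × ℚ)
    (M₀ : Fin m₀ → (Fin 2 → ℚ) × ℚ) (ylo yhi : (Fin 2 → ℚ) × ℚ) (hbd : Bornology.IsBounded s.domain)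
    (hdom : s.domain = gDom 2 1 m' M (fun _ => Sum.inr u) (fun _ => Sum.inr v))
    (hint : EqOn s.integrand (glit 2 1 p L e ℓ₁ ℓ₂ 0 1 (fun _ => some 0)) s.domain)
    (hcell : ∀ z : Fin (2 + 1 + 1) → ℝ, (∀ j, 0 < affF 2 1 (M j) z) → 0 < affF 2 1 u z ∧ affF 2 1 u z < affF 2 1 v z)
    (hsec : ∀ z : Fin (2 + 1 + 1) → ℝ, (∀ j, 0 < affF 2 1 (M j) z) ↔ ((∀ j, 0 < affB 2 1 (M₀ j) z) ∧
      affB 2 1 ylo z < z (Fin.castAdd 1 (Fin.last 2)) ∧ z (Fin.castAdd 1 (Fin.last 2)) < affB 2 1 yhi z))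
    (hδ : ∃ δ : ℝ, 0 < δ ∧ ∀ z : Fin (2 + 1 + 1) → ℝ, (∀ j, 0 < affB 2 1 (M₀ j) z) →
      δ ≤ |affB 2 1 ylo z - affB 2 1 ℓ₂ z| ∧ δ ≤ |affB 2 1 yhi z - affB 2 1 ℓ₂ z|)
    (htr : ∃ z ∈ closure {z : Fin (2 + 1 + 1) → ℝ | ∀ j, 0 < affF 2 1 (M j) z},
      affB 2 1 ylo z = affB 2 1 yhi z ∧ affF 2 1 u z = affF 2 1 v z ∧
        affB 2 1 (restr 2 u) z + (u.1 (Fin.last 2) : ℝ) * affB 2 1 ℓ₂ z = 0) :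
    ∃ c ∈ AddSubgroup.closure (GGset 2 2 1), KZ.of s - c ∈ KZ.relations := by
  classical
  -- dependent height and width
  by_cases hdep : ∃ c : ℚ, (yhi - ylo).1 = c • (restr 2 v - restr 2 u).1 ∨ (restr 2 v - restr 2 u).1 = c • (yhi - ylo).1
  · obtain ⟨z, hz, h1, h2, -⟩ := htr
    exact good_parCell_of_flat_dep L e ℓ₁ ℓ₂ s M M₀ ylo yhi p u v hbd hdom hint hpar hcell hsec ⟨z, hz, h1, h2⟩ hdep
  have hh : (yhi - ylo).1 ≠ 0 := fun h => hdep ⟨0, Or.inl (by rw [h, zero_smul])⟩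
  have hdet : detQ (yhi - ylo) (restr 2 v - restr 2 u) ≠ 0 :=
    detQ_ne_zero_of_indep _ _ hh fun ⟨c, hc⟩ => hdep ⟨c, Or.inr hc⟩
  set hF : (Fin 2 → ℚ) × ℚ := yhi - ylo with hhF
  set wF : (Fin 2 → ℚ) × ℚ := restr 2 v - restr 2 u with hwF
  set X : Fin 2 → ℚ := flatPtQ hF wF with hXdef
  have hhz : ∀ z : Fin (2 + 1 + 1) → ℝ, affB 2 1 hF z = affB 2 1 yhi z - affB 2 1 ylo z := fun z => by
    rw [hhF, affB_sub]
  have hwz : ∀ z : Fin (2 + 1 + 1) → ℝ, affB 2 1 wF z = affF 2 1 v z - affF 2 1 u z := fun z => by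
    rw [hwF, affB_sub, width_eq u v hpar]
  -- the triple point projects to the flat point; the pole stays away there
  obtain ⟨z₀, hz₀, h1, h2, -⟩ := htr
  have hXz : z₀ 0 = (X 0 : ℝ) ∧ z₀ 1 = (X 1 : ℝ) :=
    flatPtQ_spec hF wF hdet z₀ (by rw [hhz, h1, sub_self]) (by rw [hwz, h2, sub_self])
  set Y : ℚ := valX ylo X with hYdef
  obtain ⟨δ, hδ0, hδ⟩ := hδ
  have hY : Y - valX ℓ₂ X ≠ 0 := by
    have hle : δ ≤ |affB 2 1 ylo z₀ - affB 2 1 ℓ₂ z₀| :=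
      le_of_closure_rows (M := M) (f := fun _ => δ) (g := fun w => |affB 2 1 ylo w - affB 2 1 ℓ₂ w|)
        continuous_const ((continuous_affB_one ylo).sub (continuous_affB_one ℓ₂)).abs
        (fun w hw => (hδ w ((hsec w).1 hw).1).1) z₀ hz₀
    rw [affB_eq_valX ylo X z₀ hXz, affB_eq_valX ℓ₂ X z₀ hXz] at hle
    intro h0
    have : ((Y - valX ℓ₂ X : ℚ) : ℝ) = 0 := by rw [h0, Rat.cast_zero]
    push_cast at this
    rw [hYdef] at this
    rw [this, abs_zero] at hle
    exact absurd hle (not_le.2 hδ0)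
  -- the width is a non-constant silent form
  have hw : (v - u).1 0 ≠ 0 ∨ (v - u).1 1 ≠ 0 := by
    by_contra hw0
    push Not at hw0
    apply hdet
    have e0 : wF.1 0 = (v - u).1 0 := rfl
    have e1 : wF.1 1 = (v - u).1 1 := rfl
    rw [detQ, e0, e1, hw0.1, hw0.2, mul_zero, mul_zero, sub_self]
  have hl2 : (Fin.last 2 : Fin (2 + 1)) = 2 := rfl
  rw [hl2] at hu hpar
  -- Stage A: the generic slope and level parameter
  obtain ⟨q, hq, θ, hθ0, hθ1, hA⟩ := exists_goodDirs L e ℓ₂ u v X Y hu hpar hw hY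
  -- Stage B: the radius
  set K : ℚ := |hF.1 0| + |hF.1 1| + (|ylo.1 0| + |ylo.1 1|) with hKdef
  have hK : 0 ≤ K := by positivity
  obtain ⟨r, hr, hB⟩ := exists_radius L ℓ₂ u v X Y q θ K hK
  rw [← hl2] at hu hpar
  -- localise at the flat point
  refine good_quadCell_of_inner L e ℓ₁ ℓ₂ s M M₀ ylo yhi p u v hbd hdom hint hu hpar hcell hsec hdet r hr
    fun t hsub hi hd hs => ?_
  have hbase : ∀ z : Fin (2 + 1 + 1) → ℝ, (∀ j, 0 < affF 2 1 ((Fin.snoc (Fin.snoc (Fin.snoc (Fin.snoc M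
      (liftX (boxAtQ X r 0))) (liftX (boxAtQ X r 1))) (liftX (boxAtQ X r 2))) (liftX (boxAtQ X r 3)) :
        Fin (m' + 1 + 1 + 1 + 1) → _) j) z) → ∀ j, 0 < affF 2 1 (M j) z := fun z hz =>
    (rows_snoc (rows_snoc (rows_snoc (rows_snoc hz).1).1).1).1
  -- the box around `P₀` on the inner piece
  have hbox : ∀ z : Fin (2 + 1 + 1) → ℝ, (∀ j, 0 < affF 2 1 ((Fin.snoc (Fin.snoc (Fin.snoc (Fin.snoc M
      (liftX (boxAtQ X r 0))) (liftX (boxAtQ X r 1))) (liftX (boxAtQ X r 2))) (liftX (boxAtQ X r 3)) :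
        Fin (m' + 1 + 1 + 1 + 1) → _) j) z) →
      |z 0 - X 0| < r ∧ |z 1 - X 1| < r ∧ |z 2 - Y| < K * r := by
    intro z hz
    have h3 := (rows_snoc hz).2
    have h2 := (rows_snoc (rows_snoc hz).1).2
    have h1 := (rows_snoc (rows_snoc (rows_snoc hz).1).1).2
    have h0 := (rows_snoc (rows_snoc (rows_snoc (rows_snoc hz).1).1).1).2
    rw [affF_liftX] at h0 h1 h2 h3
    simp [boxAtQ, affB_three] at h0 h1 h2 h3
    have hx0 : |z 0 - X 0| < r := abs_lt.2 ⟨by linarith, by linarith⟩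
    have hx1 : |z 1 - X 1| < r := abs_lt.2 ⟨by linarith, by linarith⟩
    refine ⟨hx0, hx1, ?_⟩
    -- the `y`-range pinches at `X`
    obtain ⟨-, hylo, hyhi⟩ := (hsec z).1 (hbase z hz)
    have hy : z (Fin.castAdd 1 (Fin.last 2)) = z 2 := rfl
    rw [hy] at hylo hyhi
    have hhX : valX hF X = 0 := valX_flatPtQ_left hF wF hdet
    have eh : affB 2 1 yhi z - affB 2 1 ylo z = (hF.1 0 : ℝ) * (z 0 - X 0) + (hF.1 1 : ℝ) * (z 1 - X 1) := by
      rw [← hhz, affB_eq_valX_add hF X z, hhX, Rat.cast_zero, zero_add]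
    have el : affB 2 1 ylo z - (Y : ℝ) = (ylo.1 0 : ℝ) * (z 0 - X 0) + (ylo.1 1 : ℝ) * (z 1 - X 1) := by
      rw [affB_eq_valX_add ylo X z, hYdef]
      ring
    have ha0 := abs_lt.1 hx0
    have ha1 := abs_lt.1 hx1
    have b1 : |(hF.1 0 : ℝ) * (z 0 - X 0) + (hF.1 1 : ℝ) * (z 1 - X 1)| ≤ (|(hF.1 0 : ℝ)| + |(hF.1 1 : ℝ)|) * r := by
      calc _ ≤ |(hF.1 0 : ℝ) * (z 0 - X 0)| + |(hF.1 1 : ℝ) * (z 1 - X 1)| := abs_add_le _ _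
        _ = |(hF.1 0 : ℝ)| * |z 0 - X 0| + |(hF.1 1 : ℝ)| * |z 1 - X 1| := by rw [abs_mul, abs_mul]
        _ ≤ |(hF.1 0 : ℝ)| * r + |(hF.1 1 : ℝ)| * r := by gcongr
        _ = _ := by ring
    have b2 : |(ylo.1 0 : ℝ) * (z 0 - X 0) + (ylo.1 1 : ℝ) * (z 1 - X 1)| ≤ (|(ylo.1 0 : ℝ)| + |(ylo.1 1 : ℝ)|) * r := by
      calc _ ≤ |(ylo.1 0 : ℝ) * (z 0 - X 0)| + |(ylo.1 1 : ℝ) * (z 1 - X 1)| := abs_add_le _ _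
        _ = |(ylo.1 0 : ℝ)| * |z 0 - X 0| + |(ylo.1 1 : ℝ)| * |z 1 - X 1| := by rw [abs_mul, abs_mul]
        _ ≤ |(ylo.1 0 : ℝ)| * r + |(ylo.1 1 : ℝ)| * r := by gcongr
        _ = _ := by ring
    have c1 := abs_le.1 b1
    have c2 := abs_le.1 b2
    have hKr : (K : ℝ) * r = (|(hF.1 0 : ℝ)| + |(hF.1 1 : ℝ)|) * r + (|(ylo.1 0 : ℝ)| + |(ylo.1 1 : ℝ)|) * r := by
      rw [hKdef]; push_cast; ring
    have hr' : (0 : ℝ) < r := by exact_mod_cast hr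
    have hAr : 0 ≤ (|(hF.1 0 : ℝ)| + |(hF.1 1 : ℝ)|) * r := mul_nonneg (by positivity) hr'.le
    rw [hKr, abs_lt]
    constructor
    · linarith [c2.1]
    · linarith [c1.2, c2.2]
  -- the inner piece
  exact good_inner L e ℓ₁ ℓ₂ t _ _ ylo yhi p u v (hbd.subset hsub) hd (by rw [hi]; exact hint.mono hsub)
    (fun z hz => (hcell z (hbase z hz)).2) hs X Y q θ hq hθ0 hθ1 hA
    fun σ₀ σ₁ hσ₀ hσ₁ => ⟨fun c hc h0 z hz => (hB σ₀ σ₁ hσ₀ hσ₁ z (hbox z hz).1 (hbox z hz).2.1 (hbox z hz).2.2).1 c hc h0,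
      fun j z hz => (hB σ₀ σ₁ hσ₀ hσ₁ z (hbox z hz).1 (hbox z hz).2.1 (hbox z hz).2.2).2 j⟩

end HUFinal

end RebasePos

/-- **Registered part of `stub_rebaseSimplePosOnePos` (line `janus-bands`): the residue `HU`
of the one-fibre rebase at `B = 2` is good** (`RebasePos.good_HU_two`): a thin parallel cell
over a product cell of the base `(x₁, x₂, y)` whose closed cell carries a triple point with the
base pole at positive distance from the `y`-range lies in the subgroup generated by `GG 2 2 1`
modulo `KZ.relations` (re-selection of the distinguished coordinate and the separation engine
with the rebased fibre structure preserved). -/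
theorem rebaseSimplePos_HU_two (m m' m₀ : ℕ) (L : Fin m → (Fin 2 → ℚ) × ℚ) (e : Fin m → ℕ) (ℓ₁ ℓ₂ : (Fin 2 → ℚ) × ℚ) (p : MvPolynomial (Fin 2) ℚ) (u v : (Fin (2 + 1) → ℚ) × ℚ) (hu : u.1 (Fin.last 2) ≠ 0) (hpar : u.1 (Fin.last 2) = v.1 (Fin.last 2)) (s : KZ.IntegralRep (2 + 1 + 1)) (M : Fin m' → (Fin (2 + 1) → ℚ) × ℚ) (M₀ : Fin m₀ → (Fin 2 → ℚ) × ℚ) (ylo yhi : (Fin 2 → ℚ) × ℚ) (hbd : Bornology.IsBounded s.domain) (hdom : s.domain = SeparatePos.gDom 2 1 m' M (fun _ => Sum.inr u) (fun _ => Sum.inr v)) (hint : Set.EqOn s.integrand (RebasePos.glit 2 1 p L e ℓ₁ ℓ₂ 0 1 (fun _ => some 0)) s.domain) (hcell : ∀ z : Fin (2 + 1 + 1) → ℝ, (∀ j, 0 < SeparatePos.affF 2 1 (M j) z) → 0 < SeparatePos.affF 2 1 u z ∧ SeparatePos.affF 2 1 u z < SeparatePos.affF 2 1 v z) (hsec :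 ∀ z : Fin (2 + 1 + 1) → ℝ, (∀ j, 0 < SeparatePos.affF 2 1 (M j) z) ↔ ((∀ j, 0 < SeparatePos.affB 2 1 (M₀ j) z) ∧ SeparatePos.affB 2 1 ylo z < z (Fin.castAdd 1 (Fin.last 2)) ∧ z (Fin.castAdd 1 (Fin.last 2)) < SeparatePos.affB 2 1 yhi z)) (hδ : ∃ δ : ℝ, 0 < δ ∧ ∀ z : Fin (2 + 1 + 1) → ℝ, (∀ j, 0 < SeparatePos.affB 2 1 (M₀ j) z) → δ ≤ |SeparatePos.affB 2 1 ylo z - SeparatePos.affB 2 1 ℓ₂ z| ∧ δ ≤ |SeparatePos.affB 2 1 yhi z - SeparatePos.affB 2 1 ℓ₂ z|) (htr : ∃ z ∈ closure {z : Fin (2 + 1 + 1) → ℝ | ∀ j, 0 < SeparatePos.affF 2 1 (M j) z}, SeparatePos.affB 2 1 ylo z = SeparatePos.affB 2 1 yhi z ∧ SeparatePos.affF 2 1 u z = SeparatePos.affF 2 1 v z ∧ SeparatePos.affB 2 1 (SeparatePos.restr 2 u) z + (u.1 (Fin.last 2) : ℝ) * SeparatePos.affB 2 1 ℓ₂ z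 = 0) : ∃ c ∈ AddSubgroup.closure (SeparatePos.GGset 2 2 1), KZ.of s - c ∈ KZ.relations :=
  RebasePos.good_HU_two L e ℓ₁ ℓ₂ p u v hu hpar s M M₀ ylo yhi hbd hdom hint hcell hsec hδ htr

/-- **The stub `stub_rebaseSimplePosOnePos` at `b = 0`, UNCONDITIONALLY** (exactly its signature
at `b = 0`): `GS 2 1 → closure (GG 2 2 1 ∪ JJ 2 2 ∪ JD 3)` modulo `KZ.relations`. The residue `HU`
of `rebaseSimplePosOnePos_two_of_HU'` is discharged by `RebasePos.good_HU_two` (with `ε = 1`). -/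
theorem rebaseSimplePosOnePos_two' (GS : ℕ → ℕ → Set KZ.FormalRep) (GG : ℕ → ℕ → ℕ → Set KZ.FormalRep) (hGS : ∀ b k, GS b k = {w : KZ.FormalRep | ∃ (m m' n₁ n₂ : ℕ) (s : KZ.IntegralRep (b + 1 + k)) (M : Fin m' → (Fin (b + 1) → ℚ) × ℚ) (L : Fin m → (Fin b → ℚ) × ℚ) (e : Fin m → ℕ) (p : MvPolynomial (Fin b) ℚ) (ℓ₁ ℓ₂ : (Fin b → ℚ) × ℚ) (a : Fin k → Option ((Fin (b + 1) → ℚ) × ℚ)) (lo hi : Fin k → Fin k ⊕ ((Fin (b + 1) → ℚ) × ℚ)), (n₁ = 0 ∨ n₂ = 0) ∧ n₂ = 1 ∧ Bornology.IsBounded s.domain ∧ s.domain = {z | (∀ j, 0 < ∑ i, ((M j).1 i : ℝ) * z (Fin.castAdd k i) + ((M j).2 : ℝ)) ∧ ∀ i, Sum.elim (fun j => z (Fin.natAdd (b + 1) j)) (fun c => ∑ i', (c.1 i' : ℝ) * z (Fin.castAdd k i') + (c.2 : ℝ)) (lo i) < z (Fin.natAdd (b + 1) i) ∧ z (Fin.natAdd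 (b + 1) i) < Sum.elim (fun j => z (Fin.natAdd (b + 1) j)) (fun c => ∑ i', (c.1 i' : ℝ) * z (Fin.castAdd k i') + (c.2 : ℝ)) (hi i)} ∧ EqOn s.integrand (fun z => MvPolynomial.aeval (fun i => z (Fin.castAdd k (Fin.castSucc i))) p / (∏ j, (∑ i, ((L j).1 i : ℝ) * z (Fin.castAdd k (Fin.castSucc i)) + ((L j).2 : ℝ)) ^ e j) * ((z (Fin.castAdd k (Fin.last b)) - (∑ i, (ℓ₁.1 i : ℝ) * z (Fin.castAdd k (Fin.castSucc i)) + (ℓ₁.2 : ℝ))) ^ n₁ / (z (Fin.castAdd k (Fin.last b)) - (∑ i, (ℓ₂.1 i : ℝ) * z (Fin.castAdd k (Fin.castSucc i)) + (ℓ₂.2 : ℝ))) ^ n₂) * ∏ i, (a i).elim 1 (fun c => 1 / (z (Fin.natAdd (b + 1) i) - (∑ i', (c.1 i' : ℝ) * z (Fin.castAdd k i') + (c.2 : ℝ))))) s.domain ∧ w = KZ.of s}) (hGG : ∀ b σ k, GG b σ k = {w : KZ.FormalRep | ∃ (m m' n₁ n₂ : ℕ) (s : KZ.IntegralRep (b +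 1 + k)) (M : Fin m' → (Fin (b + 1) → ℚ) × ℚ) (L : Fin m → (Fin b → ℚ) × ℚ) (e : Fin m → ℕ) (p : MvPolynomial (Fin b) ℚ) (ℓ₁ ℓ₂ : (Fin b → ℚ) × ℚ) (a : Fin k → Option ((Fin (b + 1) → ℚ) × ℚ)) (lo hi : Fin k → Fin k ⊕ ((Fin (b + 1) → ℚ) × ℚ)), (n₁ = 0 ∨ n₂ = 0) ∧ (σ = 2 → (∀ i c, a i = some c → c.1 (Fin.last b) = 0) ∧ (∀ i c, (lo i = Sum.inr c ∨ hi i = Sum.inr c) → (c.1 (Fin.last b) = 0 ∨ c = (Pi.single (Fin.last b) 1, 0)))) ∧ Bornology.IsBounded s.domain ∧ s.domain = {z | (∀ j, 0 < ∑ i, ((M j).1 i : ℝ) * z (Fin.castAdd k i) + ((M j).2 : ℝ)) ∧ ∀ i, Sum.elim (fun j => z (Fin.natAdd (b + 1) j)) (fun c => ∑ i', (c.1 i' : ℝ) * z (Fin.castAdd k i') + (c.2 : ℝ)) (lo i) < z (Fin.natAdd (b + 1) i) ∧ z (Fin.natAdd (b + 1) i) < Sum.elim (fun j => z (Fin.natAdd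 (b + 1) j)) (fun c => ∑ i', (c.1 i' : ℝ) * z (Fin.castAdd k i') + (c.2 : ℝ)) (hi i)} ∧ EqOn s.integrand (fun z => MvPolynomial.aeval (fun i => z (Fin.castAdd k (Fin.castSucc i))) p / (∏ j, (∑ i, ((L j).1 i : ℝ) * z (Fin.castAdd k (Fin.castSucc i)) + ((L j).2 : ℝ)) ^ e j) * ((z (Fin.castAdd k (Fin.last b)) - (∑ i, (ℓ₁.1 i : ℝ) * z (Fin.castAdd k (Fin.castSucc i)) + (ℓ₁.2 : ℝ))) ^ n₁ / (z (Fin.castAdd k (Fin.last b)) - (∑ i, (ℓ₂.1 i : ℝ) * z (Fin.castAdd k (Fin.castSucc i)) + (ℓ₂.2 : ℝ))) ^ n₂) * ∏ i, (a i).elim 1 (fun c => 1 / (z (Fin.natAdd (b + 1) i) - (∑ i', (c.1 i' : ℝ) * z (Fin.castAdd k i') + (c.2 : ℝ))))) s.domain ∧ w = KZ.of s}) (JJ : ℕ → ℕ → Set KZ.FormalRep) (JD : ℕ → Set KZ.FormalRep) (hJJ : ∀ b k, JJ b k = {w : KZ.FormalRep | ∃ (m m' : ℕ) (s : KZ.IntegralRep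 (b + k)) (M : Fin m' → (Fin b → ℚ) × ℚ) (L : Fin m → (Fin b → ℚ) × ℚ) (e : Fin m → ℕ) (p : MvPolynomial (Fin b) ℚ) (a : Fin k → Option ((Fin b → ℚ) × ℚ)) (lo hi : Fin k → Fin k ⊕ ((Fin b → ℚ) × ℚ)), Bornology.IsBounded s.domain ∧ s.domain = {z | (∀ j, 0 < ∑ i, ((M j).1 i : ℝ) * z (Fin.castAdd k i) + ((M j).2 : ℝ)) ∧ ∀ i, Sum.elim (fun j => z (Fin.natAdd b j)) (fun c => ∑ i', (c.1 i' : ℝ) * z (Fin.castAdd k i') + (c.2 : ℝ)) (lo i) < z (Fin.natAdd b i) ∧ z (Fin.natAdd b i) < Sum.elim (fun j => z (Fin.natAdd b j)) (fun c => ∑ i', (c.1 i' : ℝ) * z (Fin.castAdd k i') + (c.2 : ℝ)) (hi i)} ∧ EqOn s.integrand (fun z => MvPolynomial.aeval (fun i => z (Fin.castAdd k i)) p / (∏ j, (∑ i, ((L j).1 i : ℝ) * z (Fin.castAdd k i) + ((L j).2 : ℝ)) ^ e j) * ∏ i, (a i).elim 1 (fun c => 1 / (z (Fin.natAdd b i)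 - (∑ i', (c.1 i' : ℝ) * z (Fin.castAdd k i') + (c.2 : ℝ))))) s.domain ∧ w = KZ.of s}) (hJD : ∀ N, JD N = {w : KZ.FormalRep | ∃ b' k', b' + k' = N ∧ w ∈ JJ b' k'}) : ∀ x ∈ GS (0 + 2) 1, ∃ c ∈ AddSubgroup.closure (GG (0 + 2) 2 1 ∪ JJ (0 + 2) 2 ∪ JD (0 + 3)), x - c ∈ KZ.relations :=
  rebaseSimplePosOnePos_two_of_HU' GS GG hGS hGG JJ JD hJJ hJD 1 one_pos
    fun _ L e ℓ₁ ℓ₂ p u v hu hpar _ _ s' M' M₀' ylo' yhi' hbd' hdom' hint' hcell' hsec' _ _ _ hδtr =>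
      RebasePos.good_HU_two L e ℓ₁ ℓ₂ p u v hu hpar s' M' M₀' ylo' yhi' hbd' hdom' hint' hcell' hsec' hδtr.1 hδtr.2

end Summit.KontsevichZagierPeriods.ArrangementNormalForm.JanusBands
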